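import Summits.Parity.GeneralizedHardyLittlewood.Theses.LeeYangFibres
import Summits.Parity.GeneralizedHardyLittlewood.Theorems.LeeYangFibresCellParityLawSavingEngineDefs
import Summits.Parity.GeneralizedHardyLittlewood.Theorems.LeeYangFibresCellParityLawSavingReduction
import Summits.Parity.GeneralizedHardyLittlewood.Theorems.LeeYangFibresCellParityLawSavingHypAlong
import Summits.Parity.GeneralizedHardyLittlewood.Theorems.LeeYangFibresCellParityLawSavingReduceAlong
import Summits.Parity.GeneralizedHardyLittlewood.Theorems.LeeYangFibresCellParityLawSavingMainTermAlong
import Summits.Parity.GeneralizedHardyLittlewood.Theorems.LeeYangFibresCellParityLawSavingPrepAlong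
import Summits.Parity.GeneralizedHardyLittlewood.Theorems.LeeYangFibresCellParityLawSavingAssemblyAlong
import Summits.Parity.GeneralizedHardyLittlewood.Theorems.LeeYangFibresCellParityLawSeqBFacts
import Summits.Parity.GeneralizedHardyLittlewood.Theorems.LeeYangFibresCellParityLawSeqBCells
import Summits.Parity.GeneralizedHardyLittlewood.Theorems.LeeYangFibresCellParityLawDimension
import Summits.Parity.GeneralizedHardyLittlewood.Theorems.LeeYangFibresCellParityLawDimensionLow
import Summits.Parity.GeneralizedHardyLittlewood.Theorems.LeeYangFibresCellParityLawMertensLowerHead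
import HarnessLib

/-!
# Route `LeeYangFibres`, crux `CellParityLawSaving` (stmt-Parity-18104), line `superpoly-band-same-atom`:
# the engine along the schedule (sorry-free) and the CONDITIONAL closure of the crux modulo its two research inputs

**Theorem 1 (`engineSav2_holds`, sorry-free).** The ENGINE along the schedule holds unconditionally as an implication:
the kernel `SuperPolyRoughCellLaw a` for some `a > 0` and the atom `SectionLevelAlong t` (`t ≥ 1`) give, for every
`t ≥ 1`, `LawSavAt t → SectionLawSavAt t` — Bombieri's one-parameter parity law for every coordinate section of every
non-degenerate `(t+1)`-form one-dimensional system ALONG THE SCHEDULE `u = U(N) = slowDegree N` with a log-power saving,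
granted the law for the `t`-form sub-systems. It is the composition (`engineSav2_of_pieces`, vocabulary file
`LeeYangFibresCellParityLawSavingEngineDefs`) of the five landed glue stubs of the line — `stub_hypAlong` (p162981: the
kernel's hypotheses for the localised section sequences along the schedule), `stub_reduceAlong` (p163375: the kernel
applied at deficit `η = 2(log log N)^{-B₂}`, `aB₂ ≥ 2`), `stub_mainTermAlong` (p163446: two-sided Mertens at `N^{1/U}` and
Alladi along the schedule), `stub_prepAlong` (p163067: degenerate cases, Euler ratio, fibre mass from the sub-system
law), `stub_assemblyAlong` (p163257: localisation / small mass / raw law / conversion) — with the sister crux's landed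
`u`-free inputs `stub_sectionSeqBFacts`, `stub_sectionSeqBCells`, `stub_sectionDimension`, `stub_sectionDimensionLow`,
`stub_sectionMertensLowerHead`, `stub_singularRatio` and this line's `stub_densityAlong` (p159270).

**Theorem 2 (`scheduleTransfer`, sorry-free; CONDITIONAL closure).** Ideator 3's line statement:
`(∃ a > 0, SuperPolyRoughCellLaw a) → (∀ t ≥ 1, SectionLevelAlong t) → LeeYangFibres.CellParityLawSaving` —
by `composeSav2` (induction on the number of forms from the landed base `lawSavAt_one`, p161685, through the landed
Walsh step `stub_walshStepSav`, p159624, fed with the engine) and the definitional reduction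
`cellParityLawSaving_of_lawSavAt`. So the crux is PROVED CONDITIONALLY on exactly two NAMED, TYPED statements, everything
else being a landed theorem:

  (K) `∃ a > 0, SuperPolyRoughCellLaw a` — the KERNEL: Bombieri's rough-cell law for ONE sifted dimension-1 sequence,
      uniform in the roughness `u ≤ √(log log x)`, with a super-polynomial rate `exp(-c η^{-a})` in the level deficit
      (research statement; Ford 2004 caps `a ≤ 2`, Friedlander–Iwaniec 1978 prove the polynomial analogue; truth open);
  (A) `∀ t ≥ 1, SectionLevelAlong t` — the ATOM: typed tuple-GEH for the section sequences at level
      `N^{1-(log log N)^{-B}}`, `N₀` uniform over `u ≤ U(N)` (conjecture by design of the route; implies the sister atom,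
      `sectionLevelAt_of_along`).

A result that uses (K) and (A) is conditional; its trust base is those two names. Schedule analogue of the sister's
`cellParityLaw_of_atom_of_kernel` (`LeeYangFibresCellParityLawConditional`).

References: E. Bombieri, Rend. Accad. Naz. XL (5) 1/2 (1975/76) [BombieriAsymptoticSieve1976]; RIMS 294 (1977) p. 5
[BombieriRIMS1977]; Friedlander–Iwaniec, Ann. Sc. Norm. Pisa (1978) §4 [FriedlanderIwaniecPisa1978]; K. Ford, Trans.
AMS 357 (2005) [Ford2004]; Green–Tao, Ann. of Math. 171 (2010) Conj. 1.4 [GreenTao2010]; Alladi 1982 [Alladi1982].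
-/

noncomputable section

open scoped BigOperators Classical
open Finset Literature.NumberTheory.Sieve
open Summit.Parity.GeneralizedHardyLittlewood.Cruxes.CellParityLaw.SectionAnnihilator

namespace Summit.Parity.GeneralizedHardyLittlewood.Cruxes.CellParityLawSaving.SuperPolyBand

/-- **`engineSav2_holds`** (registered; sorry-free): the engine along the schedule, fed with the sub-system law —
the five landed glue stubs composed with the sister's landed `u`-free inputs by `engineSav2_of_pieces`. -/
theorem engineSav2_holds : EngineSav2 :=
  engineSav2_of_pieces stub_sectionSeqBFacts stub_sectionSeqBCells stub_sectionDimension stub_sectionDimensionLow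
    stub_sectionMertensLowerHead stub_singularRatio stub_densityAlong stub_hypAlong stub_reduceAlong
    stub_mainTermAlong stub_prepAlong stub_assemblyAlong

/-- The law along the schedule for every number of forms, from the kernel and the atom (induction `composeSav2` with
the landed base, Walsh step, anatomy bounds and singular-series bookkeeping, fed with `engineSav2_holds`). -/
theorem lawSavAt_of_kernel_of_atom (hKernel : ∃ a : ℝ, 0 < a ∧ SuperPolyRoughCellLaw a)
    (hAtom : ∀ t : ℕ, 1 ≤ t → SectionLevelAlong t) : ∀ t : ℕ, 1 ≤ t → LawSavAt t :=
  composeSav2 stub_densityAlong stub_singularRatio stub_walshStepSav lawSavAt_one (engineSav2_holds hKernel hAtom)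

/-- **`scheduleTransfer`** (registered; sorry-free — the line's CONDITIONAL closure): ideator 3's line statement,
kernel → atom → crux. The crux `LeeYangFibres.CellParityLawSaving` holds conditionally on exactly the two named research
inputs of the line. -/
theorem scheduleTransfer : (∃ a : ℝ, 0 < a ∧ SuperPolyRoughCellLaw a) → (∀ t : ℕ, 1 ≤ t → SectionLevelAlong t) → Summit.Parity.GeneralizedHardyLittlewood.Theses.LeeYangFibres.CellParityLawSaving :=
  fun hKernel hAtom => cellParityLawSaving_of_lawSavAt (lawSavAt_of_kernel_of_atom hKernel hAtom)

/-- The same closure with the atom weakened to a single exponent pair: only the kernel's `a` matters for WHICH level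
the atom must supply (`B > 2/a` suffices, cf. `stub_reduceAlong`); recorded in the shape consumers cite
(`cellParityLawSaving_of_kernel_of_atom`). -/
theorem cellParityLawSaving_of_kernel_of_atom (hKernel : ∃ a : ℝ, 0 < a ∧ SuperPolyRoughCellLaw a)
    (hAtom : ∀ t : ℕ, 1 ≤ t → SectionLevelAlong t) :
    Summit.Parity.GeneralizedHardyLittlewood.Theses.LeeYangFibres.CellParityLawSaving :=
  scheduleTransfer hKernel hAtom

end Summit.Parity.GeneralizedHardyLittlewood.Cruxes.CellParityLawSaving.SuperPolyBand

end
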